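import Literature.MathematicalPhysics.QuantumLattice.HubbardUVSymbolResummedBandJets
import Literature.Analysis.Calculus.IteratedDerivMulFactorialPow
import Literature.Analysis.Calculus.IteratedDerivCompFactorial
import HarnessLib

/-!
# Jets of the mismatch-resummed ultraviolet symbol along the frames with a SINGLE factorial:
# `‖Dⁿ Ψ̃(p)‖ ≤ |c|·X·(6/Λ)·(1+δX)… ·n!·ρⁿ` (ρ explicit in the band scales and `Λ`)

Topic `MathematicalPhysics/QuantumLattice`; sequel of `HubbardUVSymbolResummedBandJets` (same objects: `Ψ̃ = w(ω,u)·R(u + w(ω,u)·v)`,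
`uvResummedFn_eq_weight_mul_resolvent`, `norm_shiftDen_resummed_ge`; there the jets were bounded with Mathlib's crude composition bound, whose pure-power
slot turns the shifted band's factorial jets into an `(n!)^{2n}` — useless for the aliasing constants of the K3 two-leg reading, cell gate-hubbard-kl located
risk «(C)-B-ALIAS-L»).  With the factorial-geometric calculus of `Literature.Analysis.Calculus.IteratedDerivCompFactorial` (composition, both sides factorial)
and `…IteratedDerivMulFactorialPow` (products) every step keeps ONE factorial:

* `norm_iteratedFDeriv_weight_comp_le_factorial` — `‖Dⁿ(w(ω,u ·))(p)‖ ≤ X·n!·(4E_u(1 + 4/Λ))ⁿ` (band jets `‖Dⁱu‖ ≤ i!·E_uⁱ`);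
* `norm_iteratedFDeriv_shiftedBand_le_factorial` — `‖Dⁿφ(p)‖ ≤ (1+δX)·n!·(2ρ₁)ⁿ`, `ρ₁ = 4E_u(1+4/Λ) + F_v`, `1 ≤ n` (mismatch jets `‖Dⁱv‖ ≤ δ·i!·F_vⁱ`);
* `norm_iteratedFDeriv_resolvent_comp_shiftedBand_le` — on/above the shell: `‖Dⁿ(R∘φ)(p)‖ ≤ |c|(6/Λ)·n!·(8ρ₁(1 + (6/Λ)(1+δX)))ⁿ`;
* **`norm_iteratedFDeriv_uvResummed_comp_le_factorial`** — `‖DⁿΨ̃(p)‖ ≤ |c|·X·(6/Λ)·n!·(2ρ₂)ⁿ`, `ρ₂ = 8ρ₁(1 + (6/Λ)(1+δX))` (everywhere: below the shell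
  the function vanishes identically near `p`).

Everything is proved; no definitions; no named facts.

## Sources

G. Benfatto, A. Giuliani, V. Mastropietro, Ann. Henri Poincaré 7 (2006) 809–898, §2.2 (2.23), (2.27)–(2.28), (2.36aa), §3 (3.2) [`BenfattoGiulianiMastropietro2006`].
-/

noncomputable section

namespace Literature.MathematicalPhysics.QuantumLattice

open Complex Finset Literature.Analysis.Calculus
open scoped Nat

variable {c Λ ω : ℝ}

section Jets

variable {E : Type} [NormedAddCommGroup E] [NormedSpace ℝ E]

/-- **Weight along a band, single factorial**: `‖Dⁿ(w(ω, u ·))(p)‖ ≤ X·n!·(4E_u(1+4/Λ))ⁿ` for `‖Dⁱu(p)‖ ≤ i!·E_uⁱ` (`1 ≤ i ≤ n`), `0 ≤ E_u`, `0 < Λ`,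
cutoff table up to `n`. [cite: BenfattoGiulianiMastropietro2006, §2.2 (2.36aa)] -/
theorem norm_iteratedFDeriv_weight_comp_le_factorial (hΛ : 0 < Λ) (ω : ℝ) {n : ℕ} {X : ℝ}
    (hX : ∀ l ≤ n, ∀ x : ℝ, ‖iteratedFDeriv ℝ l salmhoferCutoff x‖ ≤ X) {u : E → ℝ} (hu : ContDiff ℝ (⊤ : ℕ∞) u) {Eu : ℝ} (hEu : 0 ≤ Eu) (p : E)
    (hDu : ∀ i, 1 ≤ i → i ≤ n → ‖iteratedFDeriv ℝ i u p‖ ≤ i ! * Eu ^ i) :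
    ‖iteratedFDeriv ℝ n (fun q : E => uvWeightFn Λ ω (u q)) p‖ ≤ X * n ! * (4 * Eu * (1 + 4 / Λ * 1)) ^ n := by
  have hcomp : (fun q : E => uvWeightFn Λ ω (u q)) = (fun t : ℝ => uvWeightFn Λ ω t) ∘ u := rfl
  rw [hcomp]
  have h := norm_iteratedFDeriv_comp_le_of_factorial (F := ℝ) (G := ℝ) hu p (B := 1) (σ := Eu) (τ := 4 / Λ) zero_le_one hEu (by positivity) n
    (fun i hi1 hin => by rw [one_mul]; exact hDu i hi1 hin) (contDiff_uvWeightFn_band Λ ω) X 0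
    (fun k hk => by
      rw [add_zero]
      have := norm_iteratedFDeriv_uvWeightFn_band_le_geometric hΛ ω (fun l hl x => hX l (hl.trans hk) x) (u p)
      calc ‖iteratedFDeriv ℝ k (fun t : ℝ => uvWeightFn Λ ω t) (u p)‖ ≤ k ! * X * (4 / Λ) ^ k := this
        _ = X * k ! * (4 / Λ) ^ k := by ring)
  simpa [add_zero] using h

/-- **The shifted band `φ = u + w(ω,u)·v`, single factorial**: for `1 ≤ n`, `‖Dⁿφ(p)‖ ≤ (1+δX)·n!·(2ρ₁)ⁿ`, `ρ₁ = 4E_u(1+4/Λ) + F_v`, given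
`‖Dⁱu‖ ≤ i!·E_uⁱ` (`1 ≤ i`), `‖Dⁱv‖ ≤ δ·i!·F_vⁱ` (all `i ≤ n`), `E_u, F_v, δ ≥ 0`. [cite: BenfattoGiulianiMastropietro2006, §2.2 (2.36aa)] -/
theorem norm_iteratedFDeriv_shiftedBand_le_factorial (hΛ : 0 < Λ) (ω : ℝ) {n : ℕ} {X : ℝ}
    (hX : ∀ l ≤ n, ∀ x : ℝ, ‖iteratedFDeriv ℝ l salmhoferCutoff x‖ ≤ X) {u v : E → ℝ} (hu : ContDiff ℝ (⊤ : ℕ∞) u) (hv : ContDiff ℝ (⊤ : ℕ∞) v)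
    {Eu Fv δ : ℝ} (hEu : 0 ≤ Eu) (hFv : 0 ≤ Fv) (hδ : 0 ≤ δ) (p : E)
    (hDu : ∀ i, 1 ≤ i → i ≤ n → ‖iteratedFDeriv ℝ i u p‖ ≤ i ! * Eu ^ i) (hDv : ∀ i ≤ n, ‖iteratedFDeriv ℝ i v p‖ ≤ δ * i ! * Fv ^ i)
    (hn : 1 ≤ n) :
    ‖iteratedFDeriv ℝ n (fun q : E => u q + uvWeightFn Λ ω (u q) * v q) p‖ ≤
      (1 + δ * X) * n ! * (2 * (4 * Eu * (1 + 4 / Λ * 1) + Fv)) ^ n := by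
  have hX0 : 0 ≤ X := (norm_nonneg _).trans (hX 0 (Nat.zero_le _) 0)
  set ρ₁ : ℝ := 4 * Eu * (1 + 4 / Λ * 1) + Fv with hρ₁
  have hρw : 4 * Eu * (1 + 4 / Λ * 1) ≤ ρ₁ := by rw [hρ₁]; linarith
  have hpos4 : 0 ≤ 4 * Eu * (1 + 4 / Λ * 1) := by positivity
  have hρv : Fv ≤ ρ₁ := by rw [hρ₁]; linarith
  have hρ0 : 0 ≤ ρ₁ := hFv.trans hρv
  have hw : ContDiff ℝ (⊤ : ℕ∞) (fun q : E => uvWeightFn Λ ω (u q)) := (contDiff_uvWeightFn_band Λ ω).comp hu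
  -- the product term
  have hprod : ‖iteratedFDeriv ℝ n (fun q : E => uvWeightFn Λ ω (u q) * v q) p‖ ≤ X * δ * ((n ! : ℝ)) ^ (max 1 1) * (2 * ρ₁) ^ n := by
    refine norm_iteratedFDeriv_mul_le_of_factorialPow (N := ((⊤ : ℕ∞) : WithTop ℕ∞)) hw hv (by exact_mod_cast le_top) p hX0 hδ hρ0 ?_ ?_
    · intro i hi
      refine (norm_iteratedFDeriv_weight_comp_le_factorial hΛ ω (fun l hl x => hX l (hl.trans hi) x) hu hEu p
        (fun j hj1 hj => hDu j hj1 (hj.trans hi))).trans ?_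
      rw [pow_one]
      exact mul_le_mul_of_nonneg_left (pow_le_pow_left₀ (by positivity) hρw i) (by positivity)
    · intro i hi
      refine (hDv i hi).trans ?_
      rw [pow_one]
      exact mul_le_mul_of_nonneg_left (pow_le_pow_left₀ hFv hρv i) (by positivity)
  rw [max_self, pow_one] at hprod
  have hnN : ((n : ℕ∞) : WithTop ℕ∞) ≤ ((⊤ : ℕ∞) : WithTop ℕ∞) := by exact_mod_cast le_top
  rw [fun_iteratedFDeriv_add_apply (hu.contDiffAt.of_le hnN) ((hw.mul hv).contDiffAt.of_le hnN)]
  refine (norm_add_le _ _).trans ?_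
  have h1 : ‖iteratedFDeriv ℝ n u p‖ ≤ n ! * (2 * ρ₁) ^ n := by
    refine (hDu n hn le_rfl).trans (mul_le_mul_of_nonneg_left ?_ (by positivity))
    exact pow_le_pow_left₀ hEu (by nlinarith [hρw, hρ0, show (0:ℝ) ≤ 4 / Λ * 1 by positivity, show 0 ≤ Eu * (4/Λ*1) by positivity]) n
  calc ‖iteratedFDeriv ℝ n u p‖ + ‖iteratedFDeriv ℝ n (fun q : E => uvWeightFn Λ ω (u q) * v q) p‖
      ≤ n ! * (2 * ρ₁) ^ n + X * δ * n ! * (2 * ρ₁) ^ n := add_le_add h1 hprod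
    _ = (1 + δ * X) * n ! * (2 * ρ₁) ^ n := by ring

/-- **The resolvent composed with the shifted band, on and above the shell**: with `|v(p)| ≤ δ ≤ Λ/4`, `Λ²/4 ≤ ω² + u(p)²`:
`‖Dⁿ(R ∘ φ)(p)‖ ≤ |c|(6/Λ)·n!·(4·(2ρ₁)·(1 + (6/Λ)(1+δX)))ⁿ`, `R = resolventFnXi c 0 ω`. [cite: BenfattoGiulianiMastropietro2006, §2.2 (2.27)–(2.28)] -/
theorem norm_iteratedFDeriv_resolvent_comp_shiftedBand_le (hΛ : 0 < Λ) (hω : ω ≠ 0) {n : ℕ} {X : ℝ}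
    (hX : ∀ l ≤ n, ∀ x : ℝ, ‖iteratedFDeriv ℝ l salmhoferCutoff x‖ ≤ X) {u v : E → ℝ} (hu : ContDiff ℝ (⊤ : ℕ∞) u) (hv : ContDiff ℝ (⊤ : ℕ∞) v)
    {Eu Fv δ : ℝ} (hEu : 0 ≤ Eu) (hFv : 0 ≤ Fv) (hδ : 0 ≤ δ) (hδΛ : δ ≤ Λ / 4) (p : E) (hvp : |v p| ≤ δ)
    (hshell : Λ ^ 2 / 4 ≤ ω ^ 2 + u p ^ 2)
    (hDu : ∀ i, 1 ≤ i → i ≤ n → ‖iteratedFDeriv ℝ i u p‖ ≤ i ! * Eu ^ i) (hDv : ∀ i ≤ n, ‖iteratedFDeriv ℝ i v p‖ ≤ δ * i ! * Fv ^ i) :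
    ‖iteratedFDeriv ℝ n (fun q : E => resolventFnXi c 0 ω (u q + uvWeightFn Λ ω (u q) * v q)) p‖ ≤
      |c| * (6 / Λ) * n ! * (4 * (2 * (4 * Eu * (1 + 4 / Λ * 1) + Fv)) * (1 + 6 / Λ * (1 + δ * X))) ^ n := by
  have hω0 : ω + 0 ≠ 0 := by rwa [add_zero]
  have hX0 : 0 ≤ X := (norm_nonneg _).trans (hX 0 (Nat.zero_le _) 0)
  have hφ : ContDiff ℝ (⊤ : ℕ∞) (fun q : E => u q + uvWeightFn Λ ω (u q) * v q) := hu.add (((contDiff_uvWeightFn_band Λ ω).comp hu).mul hv)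
  have hcomp : (fun q : E => resolventFnXi c 0 ω (u q + uvWeightFn Λ ω (u q) * v q)) =
      resolventFnXi c 0 ω ∘ (fun q : E => u q + uvWeightFn Λ ω (u q) * v q) := rfl
  rw [hcomp]
  -- resolvent jets at the shifted band value
  have hden : Λ / 6 ≤ ‖-I * ((ω + 0 : ℝ) : ℂ) + ((u p + uvWeightFn Λ ω (u p) * v p : ℝ) : ℂ)‖ :=
    norm_shiftDen_resummed_ge hΛ hshell (abs_uvWeightFn_le_one Λ ω (u p)) (hvp.trans hδΛ)
  have h6Λ : 0 < Λ / 6 := by positivity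
  have h := norm_iteratedFDeriv_comp_le_of_factorial (F := ℝ) (G := ℂ) hφ p (B := 1 + δ * X) (σ := 2 * (4 * Eu * (1 + 4 / Λ * 1) + Fv))
    (τ := 6 / Λ) (by positivity) (by positivity) (by positivity) n
    (fun i hi1 hin => norm_iteratedFDeriv_shiftedBand_le_factorial hΛ ω (fun l hl x => hX l (hl.trans hin) x) hu hv hEu hFv hδ p
      (fun j hj1 hj => hDu j hj1 (hj.trans hin)) (fun j hj => hDv j (hj.trans hin)) hi1)
    (contDiff_resolventFnXi (c := c) hω0) (|c| * (6 / Λ)) 0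
    (fun k hk => by
      rw [add_zero, norm_iteratedFDeriv_eq_norm_iteratedDeriv, norm_iteratedDeriv_resolventFnXi hω0]
      have h1 : (Λ / 6) ^ (k + 1) ≤ ‖-I * ((ω + 0 : ℝ) : ℂ) + ((u p + uvWeightFn Λ ω (u p) * v p : ℝ) : ℂ)‖ ^ (k + 1) :=
        pow_le_pow_left₀ h6Λ.le hden _
      calc |c| * (k ! : ℝ) / ‖-I * ((ω + 0 : ℝ) : ℂ) + ((u p + uvWeightFn Λ ω (u p) * v p : ℝ) : ℂ)‖ ^ (k + 1)
          ≤ |c| * (k ! : ℝ) / (Λ / 6) ^ (k + 1) := div_le_div_of_nonneg_left (by positivity) (by positivity) h1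
        _ = |c| * (6 / Λ) * k ! * (6 / Λ) ^ k := by rw [div_eq_mul_inv, ← inv_pow, inv_div, pow_succ]; ring)
  simpa [add_zero] using h

/-- **JETS OF THE RESUMMED SYMBOL ALONG THE FRAMES, SINGLE FACTORIAL.**  `0 < Λ`, `ω ≠ 0`, cutoff table `‖χ₂^{(l)}‖ ≤ X` (`l ≤ n`), smooth bands with
`‖Dⁱu(p)‖ ≤ i!·E_uⁱ` (`1 ≤ i ≤ n`), `‖Dⁱv(p)‖ ≤ δ·i!·F_vⁱ` (`i ≤ n`), `|v(p)| ≤ δ ≤ Λ/4`, `E_u, F_v ≥ 0`.  With `ρ₁ = 4E_u(1+4/Λ) + F_v`,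
`ρ₂ = 8ρ₁(1 + (6/Λ)(1+δX))`:  `‖Dⁿ[q ↦ w(ω,u q)·resolventFnXi c 0 ω (u q + w(ω,u q)·v q)](p)‖ ≤ X·(|c|(6/Λ))·n!·(2ρ₂)ⁿ`.
[cite: BenfattoGiulianiMastropietro2006, §2.2 (2.36aa)] -/
theorem norm_iteratedFDeriv_uvResummed_comp_le_factorial (hΛ : 0 < Λ) (hω : ω ≠ 0) {n : ℕ} {X : ℝ}
    (hX : ∀ l ≤ n, ∀ x : ℝ, ‖iteratedFDeriv ℝ l salmhoferCutoff x‖ ≤ X) {u v : E → ℝ} (hu : ContDiff ℝ (⊤ : ℕ∞) u) (hv : ContDiff ℝ (⊤ : ℕ∞) v)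
    {Eu Fv δ : ℝ} (hEu : 0 ≤ Eu) (hFv : 0 ≤ Fv) (hδ : 0 ≤ δ) (hδΛ : δ ≤ Λ / 4) (p : E) (hvp : |v p| ≤ δ)
    (hDu : ∀ i, 1 ≤ i → i ≤ n → ‖iteratedFDeriv ℝ i u p‖ ≤ i ! * Eu ^ i) (hDv : ∀ i ≤ n, ‖iteratedFDeriv ℝ i v p‖ ≤ δ * i ! * Fv ^ i) :
    ‖iteratedFDeriv ℝ n (fun q : E => ((uvWeightFn Λ ω (u q) : ℝ) : ℂ) * resolventFnXi c 0 ω (u q + uvWeightFn Λ ω (u q) * v q)) p‖ ≤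
      X * (|c| * (6 / Λ)) * n ! *
        (2 * (8 * (4 * Eu * (1 + 4 / Λ * 1) + Fv) * (1 + 6 / Λ * (1 + δ * X)))) ^ n := by
  have hω0 : ω + 0 ≠ 0 := by rwa [add_zero]
  have hX0 : 0 ≤ X := (norm_nonneg _).trans (hX 0 (Nat.zero_le _) 0)
  set ρ₁ : ℝ := 4 * Eu * (1 + 4 / Λ * 1) + Fv with hρ₁
  set ρ₂ : ℝ := 8 * ρ₁ * (1 + 6 / Λ * (1 + δ * X)) with hρ₂
  have hρ₁0 : 0 ≤ ρ₁ := by rw [hρ₁]; positivity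
  have hρ₂0 : 0 ≤ ρ₂ := by rw [hρ₂]; positivity
  have hRHS0 : 0 ≤ X * (|c| * (6 / Λ)) * n ! * (2 * ρ₂) ^ n := by positivity
  -- smoothness
  have hwR : ContDiff ℝ (⊤ : ℕ∞) (fun q : E => uvWeightFn Λ ω (u q)) := (contDiff_uvWeightFn_band Λ ω).comp hu
  have hwC : ContDiff ℝ (⊤ : ℕ∞) (fun q : E => ((uvWeightFn Λ ω (u q) : ℝ) : ℂ)) := Complex.ofRealCLM.contDiff.comp hwR
  have hφ : ContDiff ℝ (⊤ : ℕ∞) (fun q : E => u q + uvWeightFn Λ ω (u q) * v q) := hu.add (hwR.mul hv)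
  have hRφ : ContDiff ℝ (⊤ : ℕ∞) (fun q : E => resolventFnXi c 0 ω (u q + uvWeightFn Λ ω (u q) * v q)) :=
    (contDiff_resolventFnXi (c := c) hω0).comp hφ
  by_cases hshell : ω ^ 2 + u p ^ 2 < Λ ^ 2 / 4
  · -- below the shell the function vanishes identically near `p`
    have hopen : ∀ᶠ q in nhds p, ω ^ 2 + u q ^ 2 < Λ ^ 2 / 4 :=
      (continuous_const.add ((hu.continuous).pow 2)).continuousAt.eventually (gt_mem_nhds hshell)
    have hev : (fun q : E => ((uvWeightFn Λ ω (u q) : ℝ) : ℂ) * resolventFnXi c 0 ω (u q + uvWeightFn Λ ω (u q) * v q)) =ᶠ[nhds p]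
        fun _ => (0 : ℂ) := by
      filter_upwards [hopen] with q hq
      have hw0 : uvWeightFn Λ ω (u q) = 0 := (uvWeightFn_eq_zero_of_lt hΛ (e := ω) (ω := u q) (by linarith)).1
      rw [hw0, Complex.ofReal_zero, zero_mul]
    rw [(hev.iteratedFDeriv ℝ n).eq_of_nhds]
    rcases Nat.eq_zero_or_pos n with hn | hn
    · subst hn; simpa using hRHS0
    · rw [iteratedFDeriv_const_of_ne (Nat.pos_iff_ne_zero.1 hn)]
      simpa using hRHS0
  · have hge : Λ ^ 2 / 4 ≤ ω ^ 2 + u p ^ 2 := not_lt.1 hshell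
    -- weight factor: class (X, 1, ρw) with ρw ≤ ρ₂; resolvent factor: class (|c|6/Λ, 1, 4·2ρ₁(…) ≤ ρ₂)
    have hρw : 4 * Eu * (1 + 4 / Λ * 1) ≤ ρ₂ := by
      rw [hρ₂]
      have h1 : 4 * Eu * (1 + 4 / Λ * 1) ≤ ρ₁ := by rw [hρ₁]; linarith
      have h2 : ρ₁ ≤ 8 * ρ₁ * (1 + 6 / Λ * (1 + δ * X)) := by
        have : 1 ≤ 8 * (1 + 6 / Λ * (1 + δ * X)) := by
          have : 0 ≤ 6 / Λ * (1 + δ * X) := by positivity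
          linarith
        nlinarith
      linarith
    have hρR : 4 * (2 * (4 * Eu * (1 + 4 / Λ * 1) + Fv)) * (1 + 6 / Λ * (1 + δ * X)) ≤ ρ₂ := by rw [hρ₂, hρ₁]; ring_nf; rfl
    have hW : ∀ i ≤ n, ‖iteratedFDeriv ℝ i (fun q : E => ((uvWeightFn Λ ω (u q) : ℝ) : ℂ)) p‖ ≤ X * ((i ! : ℝ)) ^ 1 * ρ₂ ^ i := by
      intro i hi
      have hcast : (fun q : E => ((uvWeightFn Λ ω (u q) : ℝ) : ℂ)) = Complex.ofRealLI ∘ (fun q : E => uvWeightFn Λ ω (u q)) := rfl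
      rw [hcast, Complex.ofRealLI.norm_iteratedFDeriv_comp_left ((hwR.of_le (by exact_mod_cast le_top : ((i : ℕ∞) : WithTop ℕ∞) ≤ _)).contDiffAt) le_rfl, pow_one]
      refine (norm_iteratedFDeriv_weight_comp_le_factorial hΛ ω (fun l hl x => hX l (hl.trans hi) x) hu hEu p
        (fun j hj1 hj => hDu j hj1 (hj.trans hi))).trans ?_
      exact mul_le_mul_of_nonneg_left (pow_le_pow_left₀ (by positivity) hρw i) (by positivity)
    have hR : ∀ i ≤ n, ‖iteratedFDeriv ℝ i (fun q : E => resolventFnXi c 0 ω (u q + uvWeightFn Λ ω (u q) * v q)) p‖ ≤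
        |c| * (6 / Λ) * ((i ! : ℝ)) ^ 1 * ρ₂ ^ i := by
      intro i hi
      rw [pow_one]
      refine (norm_iteratedFDeriv_resolvent_comp_shiftedBand_le hΛ hω (fun l hl x => hX l (hl.trans hi) x) hu hv hEu hFv hδ hδΛ p hvp hge
        (fun j hj1 hj => hDu j hj1 (hj.trans hi)) (fun j hj => hDv j (hj.trans hi))).trans ?_
      exact mul_le_mul_of_nonneg_left (pow_le_pow_left₀ (by positivity) hρR i) (by positivity)
    have h := norm_iteratedFDeriv_mul_le_of_factorialPow (N := ((⊤ : ℕ∞) : WithTop ℕ∞)) hwC hRφ (by exact_mod_cast le_top) p hX0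
      (by positivity) hρ₂0 hW hR
    rw [max_self, pow_one] at h
    exact h

end Jets

end Literature.MathematicalPhysics.QuantumLattice

end
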